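import Summits.Schanuel.Schanuel.Theorems.RootDecomp1KLogLogCell07

/-!
# RootDecomp1KLogLogCell — lens 1, generation 35 «LOG-LOG CELL of 33364» (RootDecomp1KLogLogCell.lean 05ce2a21…, 1940 l) — continuation (RootDecomp1KLogLogCell08): §8 the LOG-LOG cells against item 33364 (`finiteOrderLiouvilleSchanuel_logLogCell (hNW)` / `_pi`), corollaries for the TREE classes LogSqLiouville / LogHyperLiouville by name, the members `zE = (1, ℓ₂, ρ_E)`, `zEpi` (`sb_zE`, `sb_zEpi` hypothesis-free)

(lens-1 g35 `RootDecomp1KLogLogCell.lean`, sha256 05ce2a21…c847, own farm rc 0 · 0 sorry · axioms std; critic VERDICT STATUS L1698 PORT GO LOW;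
port by census-1 gen 15 in eight parts `RootDecomp1KLogLogCell01`–`08` — see the PORT NOTE of part 01; `--supports stmt-Schanuel-33364`; rung 0.)
-/

noncomputable section

open Complex IntermediateField Polynomial
open Summit.Schanuel.Schanuel.Theorems.RootDecomp1KHyper
open Summit.Schanuel.Schanuel.Theorems.RootDecomp1KHyper.HyperCell
open Summit.Schanuel.Schanuel.Theorems.RootDecomp1KGeneric
open Summit.Schanuel.Schanuel.Theorems.RootDecomp1KRelLiouvilleCell

namespace Summit.Schanuel.Schanuel.Theorems.RootDecomp1KLogLogCell

/-! ## §8  The LOG-LOG cell against item 33364, corollaries for the TREE classes, and the member `z_E = (1, ℓ₂, ρ_E)` -/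

section Cells
open LiouvilleNumber
open scoped Nat

/-- **Schanuel's bound on the log-log cell, e-version** (mod the Nesterenko–Waldschmidt measure of `e`,
`hNW : NWMeasure` — the tree decl `Summit.Schanuel.Schanuel.Theorems.RootDecomp1KHyper.NWMeasure` BY NAME,
the verbatim text of `Literature.NumberTheory.Transcendental.NesterenkoWaldschmidt1996_thm_4_2`, tree-proved;
discharge by name when that cone is built): for every log-log-Liouville real `ρ`,
`trdeg ℚ(1, ℓ₂, ρ, e, e^{ℓ₂}, e^ρ) ≥ 3`. -/
theorem sb_logLogCell (hNW : NWMeasure) {ρ : ℝ} (hρ : LogLogLiouville ρ) :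
    SB 3 ![(1 : ℂ), ((liouvilleNumber 2 : ℝ) : ℂ), (ρ : ℂ)] := by
  refine sb_of_logLogLiouville_of_logLogMeasure (n := 2) hρ ?_
    (logLogMeasure_liouvilleNumber_exp_one hNW) ?_
  · exact subset_adjoin ℚ _ (Or.inl (Or.inl ⟨2, rfl⟩))
  · refine Fin.forall_fin_two.mpr ⟨?_, ?_⟩
    · exact subset_adjoin ℚ _ (Or.inl (Or.inl ⟨1, rfl⟩))
    · exact subset_adjoin ℚ _ (Or.inl (Or.inr ⟨0, rfl⟩))

/-- **Schanuel's bound on the log-log cell, π-version — HYPOTHESIS-FREE** (π's measure is tree-proved):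
for every log-log-Liouville real `ρ`, `trdeg ℚ(π, πℓ₂, πρ, e^π, e^{πℓ₂}, e^{πρ}) ≥ 3`. -/
theorem sb_logLogCell_pi {ρ : ℝ} (hρ : LogLogLiouville ρ) :
    SB 3 ![(Real.pi : ℂ), (Real.pi : ℂ) * ((liouvilleNumber 2 : ℝ) : ℂ), (Real.pi : ℂ) * (ρ : ℂ)] := by
  set z : Fin 3 → ℂ :=
    ![(Real.pi : ℂ), (Real.pi : ℂ) * ((liouvilleNumber 2 : ℝ) : ℂ), (Real.pi : ℂ) * (ρ : ℂ)] with hz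
  have hπ0 : (Real.pi : ℂ) ≠ 0 := by exact_mod_cast Real.pi_ne_zero
  have hz0 : z 0 ∈ adjoin ℚ (SFset z ∪ {I}) := subset_adjoin ℚ _ (Or.inl (Or.inl ⟨0, rfl⟩))
  have hz1 : z 1 ∈ adjoin ℚ (SFset z ∪ {I}) := subset_adjoin ℚ _ (Or.inl (Or.inl ⟨1, rfl⟩))
  have hz2 : z 2 ∈ adjoin ℚ (SFset z ∪ {I}) := subset_adjoin ℚ _ (Or.inl (Or.inl ⟨2, rfl⟩))
  have ez0 : z 0 = (Real.pi : ℂ) := rfl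
  have ez1 : z 1 = (Real.pi : ℂ) * ((liouvilleNumber 2 : ℝ) : ℂ) := rfl
  have ez2 : z 2 = (Real.pi : ℂ) * (ρ : ℂ) := rfl
  have eρ : (ρ : ℂ) = z 2 / z 0 := by rw [ez2, ez0, mul_div_cancel_left₀ _ hπ0]
  have eℓ : ((liouvilleNumber 2 : ℝ) : ℂ) = z 1 / z 0 := by rw [ez1, ez0, mul_div_cancel_left₀ _ hπ0]
  refine sb_of_logLogLiouville_of_logLogMeasure (n := 2) hρ ?_ logLogMeasure_liouvilleNumber_pi ?_
  · rw [eρ]; exact div_mem hz2 hz0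
  · refine Fin.forall_fin_two.mpr ⟨?_, ?_⟩
    · show ((liouvilleNumber 2 : ℝ) : ℂ) ∈ _
      rw [eℓ]; exact div_mem hz1 hz0
    · exact hz0

/-- Cardinal bookkeeping: a tuple `z : Fin n → ℂ` whose range is the range of a `Fin N`-tuple, with `z`
injective, has `n ≤ N`, and the Schanuel field only sees `Set.range z`. -/
private theorem sb_of_range_eq {n N : ℕ} {z : Fin n → ℂ} {w : Fin N → ℂ} (hz : Function.Injective z)
    (hrange : Set.range z = Set.range w) (hw : SB N w) :
    (n : Cardinal) ≤ Algebra.trdeg ℚ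
      ↥(IntermediateField.adjoin ℚ (Set.range z ∪ Set.range (Complex.exp ∘ z))) := by
  have e : Set.range z ∪ Set.range (Complex.exp ∘ z) = Set.range w ∪ Set.range (Complex.exp ∘ w) := by
    rw [Set.range_comp, Set.range_comp, hrange]
  have hnN : (n : Cardinal) ≤ (N : Cardinal) :=
    calc (n : Cardinal) = Cardinal.mk (Fin n) := (Cardinal.mk_fin n).symm
      _ = Cardinal.mk (Set.range z) := (Cardinal.mk_range_eq z hz).symm
      _ = Cardinal.mk (Set.range w) := by rw [hrange]
      _ ≤ Cardinal.mk (Fin N) := Cardinal.mk_range_le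
      _ = N := Cardinal.mk_fin N
  rw [e]
  exact hnN.trans hw

/-- **ITEM 33364 ON THE LOG-LOG CELL (e-version, mod `hNW` by name).** Binders of
`Summit.Schanuel.Schanuel.Theses.RootDecomp1K.FiniteOrderLiouvilleSchanuel` VERBATIM, with ONE line inserted
after `LinearIndependent ℚ z` — the cell `Set.range z = Set.range ![1, ℓ₂, ρ]`, `ρ` ranging over the
LOG-LOG-LIOUVILLE reals (outer parameters `ρ`, `hρ : LogLogLiouville ρ`).  The two Diophantine binders are not
used by the proof (the conclusion holds outright on the cell); they are CERTIFIED at the member `z_E` below. -/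
theorem finiteOrderLiouvilleSchanuel_logLogCell (hNW : NWMeasure) {ρ : ℝ} (hρ : LogLogLiouville ρ) :
    ∀ (n : ℕ) (z : Fin n → ℂ), LinearIndependent ℚ z →
      Set.range z = Set.range ![(1 : ℂ), ((liouvilleNumber 2 : ℝ) : ℂ), (ρ : ℂ)] →
      (∀ ω : ℕ, ∃ h : Fin n → ℤ, h ≠ 0 ∧ ‖∑ i, (h i : ℂ) * z i‖ < 1 / (1 + ∑ i, (|h i| : ℝ)) ^ ω) →
      (¬ ∀ m : ℕ, ∃ h : Fin n → ℤ, h ≠ 0 ∧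
        ‖∑ i, (h i : ℂ) * z i‖ < Real.exp (-((1 + ∑ i, (|h i| : ℝ)) ^ m))) →
      (n : Cardinal) ≤ Algebra.trdeg ℚ
        ↥(IntermediateField.adjoin ℚ (Set.range z ∪ Set.range (Complex.exp ∘ z))) := by
  intro n z hz hrange _ _
  exact sb_of_range_eq hz.injective hrange (sb_logLogCell hNW hρ)

/-- **ITEM 33364 ON THE LOG-LOG CELL, π-version — HYPOTHESIS-FREE.** Same binders verbatim, the cell line
`Set.range z = Set.range ![π, πℓ₂, πρ]`, `ρ` log-log-Liouville. -/
theorem finiteOrderLiouvilleSchanuel_logLogCell_pi {ρ : ℝ} (hρ : LogLogLiouville ρ) :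
    ∀ (n : ℕ) (z : Fin n → ℂ), LinearIndependent ℚ z →
      Set.range z = Set.range ![(Real.pi : ℂ), (Real.pi : ℂ) * ((liouvilleNumber 2 : ℝ) : ℂ),
        (Real.pi : ℂ) * (ρ : ℂ)] →
      (∀ ω : ℕ, ∃ h : Fin n → ℤ, h ≠ 0 ∧ ‖∑ i, (h i : ℂ) * z i‖ < 1 / (1 + ∑ i, (|h i| : ℝ)) ^ ω) →
      (¬ ∀ m : ℕ, ∃ h : Fin n → ℤ, h ≠ 0 ∧
        ‖∑ i, (h i : ℂ) * z i‖ < Real.exp (-((1 + ∑ i, (|h i| : ℝ)) ^ m))) →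
      (n : Cardinal) ≤ Algebra.trdeg ℚ
        ↥(IntermediateField.adjoin ℚ (Set.range z ∪ Set.range (Complex.exp ∘ z))) := by
  intro n z hz hrange _ _
  exact sb_of_range_eq hz.injective hrange (sb_logLogCell_pi hρ)

/-! ### Corollaries for the TREE classes BY NAME (the literal (γ) text of K-R19 and g34's class) -/

/-- **COROLLARY — THE LOG-SQUARE-LIOUVILLE CELL of item 33364 (e-version, mod `hNW` by name)**: the class is
the TREE decl `Summit.Schanuel.Schanuel.Theorems.RootDecomp1KGeneric.LogSqLiouville` BY NAME (fully qualified),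
i.e. `{(1, ℓ₂, ρ) : ρ log-square-Liouville}` — the literal text of RULE K-R19 (γ).  Every log-square-Liouville
real is log-log-Liouville (`logLogLiouville_of_logSqLiouville`, since `(log q)² ≥ log q · loglog q`). -/
theorem finiteOrderLiouvilleSchanuel_logSqCell (hNW : NWMeasure) {ρ : ℝ}
    (hρ : Summit.Schanuel.Schanuel.Theorems.RootDecomp1KGeneric.LogSqLiouville ρ) :
    ∀ (n : ℕ) (z : Fin n → ℂ), LinearIndependent ℚ z →
      Set.range z = Set.range ![(1 : ℂ), ((liouvilleNumber 2 : ℝ) : ℂ), (ρ : ℂ)] →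
      (∀ ω : ℕ, ∃ h : Fin n → ℤ, h ≠ 0 ∧ ‖∑ i, (h i : ℂ) * z i‖ < 1 / (1 + ∑ i, (|h i| : ℝ)) ^ ω) →
      (¬ ∀ m : ℕ, ∃ h : Fin n → ℤ, h ≠ 0 ∧
        ‖∑ i, (h i : ℂ) * z i‖ < Real.exp (-((1 + ∑ i, (|h i| : ℝ)) ^ m))) →
      (n : Cardinal) ≤ Algebra.trdeg ℚ
        ↥(IntermediateField.adjoin ℚ (Set.range z ∪ Set.range (Complex.exp ∘ z))) :=
  finiteOrderLiouvilleSchanuel_logLogCell hNW (logLogLiouville_of_logSqLiouville hρ)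

/-- **COROLLARY — THE LOG-SQUARE-LIOUVILLE CELL, π-version — HYPOTHESIS-FREE** (tree class BY NAME). -/
theorem finiteOrderLiouvilleSchanuel_logSqCell_pi {ρ : ℝ}
    (hρ : Summit.Schanuel.Schanuel.Theorems.RootDecomp1KGeneric.LogSqLiouville ρ) :
    ∀ (n : ℕ) (z : Fin n → ℂ), LinearIndependent ℚ z →
      Set.range z = Set.range ![(Real.pi : ℂ), (Real.pi : ℂ) * ((liouvilleNumber 2 : ℝ) : ℂ),
        (Real.pi : ℂ) * (ρ : ℂ)] →
      (∀ ω : ℕ, ∃ h : Fin n → ℤ, h ≠ 0 ∧ ‖∑ i, (h i : ℂ) * z i‖ < 1 / (1 + ∑ i, (|h i| : ℝ)) ^ ω) →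
      (¬ ∀ m : ℕ, ∃ h : Fin n → ℤ, h ≠ 0 ∧
        ‖∑ i, (h i : ℂ) * z i‖ < Real.exp (-((1 + ∑ i, (|h i| : ℝ)) ^ m))) →
      (n : Cardinal) ≤ Algebra.trdeg ℚ
        ↥(IntermediateField.adjoin ℚ (Set.range z ∪ Set.range (Complex.exp ∘ z))) :=
  finiteOrderLiouvilleSchanuel_logLogCell_pi (logLogLiouville_of_logSqLiouville hρ)

/-- **COROLLARY — g34's LOG-HYPER cell is a SUB-cell** (tree class
`Summit.Schanuel.Schanuel.Theorems.RootDecomp1KRelLiouvilleCell.LogHyperLiouville` BY NAME; e-version mod `hNW`). -/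
theorem finiteOrderLiouvilleSchanuel_logHyperCell (hNW : NWMeasure) {ρ : ℝ}
    (hρ : Summit.Schanuel.Schanuel.Theorems.RootDecomp1KRelLiouvilleCell.LogHyperLiouville ρ) :
    ∀ (n : ℕ) (z : Fin n → ℂ), LinearIndependent ℚ z →
      Set.range z = Set.range ![(1 : ℂ), ((liouvilleNumber 2 : ℝ) : ℂ), (ρ : ℂ)] →
      (∀ ω : ℕ, ∃ h : Fin n → ℤ, h ≠ 0 ∧ ‖∑ i, (h i : ℂ) * z i‖ < 1 / (1 + ∑ i, (|h i| : ℝ)) ^ ω) →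
      (¬ ∀ m : ℕ, ∃ h : Fin n → ℤ, h ≠ 0 ∧
        ‖∑ i, (h i : ℂ) * z i‖ < Real.exp (-((1 + ∑ i, (|h i| : ℝ)) ^ m))) →
      (n : Cardinal) ≤ Algebra.trdeg ℚ
        ↥(IntermediateField.adjoin ℚ (Set.range z ∪ Set.range (Complex.exp ∘ z))) :=
  finiteOrderLiouvilleSchanuel_logLogCell hNW (logLogLiouville_of_logHyperLiouville hρ)

/-- **COROLLARY — g34's LOG-HYPER cell, π-version — HYPOTHESIS-FREE** (tree class BY NAME). -/
theorem finiteOrderLiouvilleSchanuel_logHyperCell_pi {ρ : ℝ}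
    (hρ : Summit.Schanuel.Schanuel.Theorems.RootDecomp1KRelLiouvilleCell.LogHyperLiouville ρ) :
    ∀ (n : ℕ) (z : Fin n → ℂ), LinearIndependent ℚ z →
      Set.range z = Set.range ![(Real.pi : ℂ), (Real.pi : ℂ) * ((liouvilleNumber 2 : ℝ) : ℂ),
        (Real.pi : ℂ) * (ρ : ℂ)] →
      (∀ ω : ℕ, ∃ h : Fin n → ℤ, h ≠ 0 ∧ ‖∑ i, (h i : ℂ) * z i‖ < 1 / (1 + ∑ i, (|h i| : ℝ)) ^ ω) →
      (¬ ∀ m : ℕ, ∃ h : Fin n → ℤ, h ≠ 0 ∧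
        ‖∑ i, (h i : ℂ) * z i‖ < Real.exp (-((1 + ∑ i, (|h i| : ℝ)) ^ m))) →
      (n : Cardinal) ≤ Algebra.trdeg ℚ
        ↥(IntermediateField.adjoin ℚ (Set.range z ∪ Set.range (Complex.exp ∘ z))) :=
  finiteOrderLiouvilleSchanuel_logLogCell_pi (logLogLiouville_of_logHyperLiouville hρ)

/-- **COROLLARY — the HYPER-LIOUVILLE third coordinate** (the route's class
`Summit.Schanuel.Schanuel.Theorems.RootDecomp1KHyper.HyperCell.HyperLiouville` BY NAME; π-version, hypothesis-free). -/
theorem finiteOrderLiouvilleSchanuel_hyperCell_pi {ρ : ℝ}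
    (hρ : Summit.Schanuel.Schanuel.Theorems.RootDecomp1KHyper.HyperCell.HyperLiouville ρ) :
    ∀ (n : ℕ) (z : Fin n → ℂ), LinearIndependent ℚ z →
      Set.range z = Set.range ![(Real.pi : ℂ), (Real.pi : ℂ) * ((liouvilleNumber 2 : ℝ) : ℂ),
        (Real.pi : ℂ) * (ρ : ℂ)] →
      (∀ ω : ℕ, ∃ h : Fin n → ℤ, h ≠ 0 ∧ ‖∑ i, (h i : ℂ) * z i‖ < 1 / (1 + ∑ i, (|h i| : ℝ)) ^ ω) →
      (¬ ∀ m : ℕ, ∃ h : Fin n → ℤ, h ≠ 0 ∧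
        ‖∑ i, (h i : ℂ) * z i‖ < Real.exp (-((1 + ∑ i, (|h i| : ℝ)) ^ m))) →
      (n : Cardinal) ≤ Algebra.trdeg ℚ
        ↥(IntermediateField.adjoin ℚ (Set.range z ∪ Set.range (Complex.exp ∘ z))) :=
  finiteOrderLiouvilleSchanuel_logLogCell_pi (logLogLiouville_of_hyperLiouville hρ)

/-! ### The member `z_E = (1, ℓ₂, ρ_E)` and its π-twin `z_E^π = (π, πℓ₂, πρ_E)` — OUTSIDE g34's cell -/

/-- The log-log member `z_E := (1, ℓ₂, ρ_E)`. -/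
noncomputable def zE : Fin 3 → ℂ := ![(1 : ℂ), ((liouvilleNumber 2 : ℝ) : ℂ), ((rhoE : ℝ) : ℂ)]

/-- Its π-twin `z_E^π := (π, πℓ₂, πρ_E)`. -/
noncomputable def zEpi : Fin 3 → ℂ :=
  ![(Real.pi : ℂ), (Real.pi : ℂ) * ((liouvilleNumber 2 : ℝ) : ℂ), (Real.pi : ℂ) * ((rhoE : ℝ) : ℂ)]

/-- An integer form in `z_E = (1, ℓ₂, ρ_E)` is the real number `g₀ + g₁ ℓ₂ + g₂ ρ_E`. -/
theorem zE_form (g : Fin 3 → ℤ) :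
    ∑ i, (g i : ℂ) * zE i = (((g 0 : ℝ) + g 1 * liouvilleNumber 2 + g 2 * rhoE : ℝ) : ℂ) := by
  rw [Fin.sum_univ_three]
  simp only [zE, Matrix.cons_val_zero, Matrix.cons_val_one, Matrix.cons_val_two, Matrix.head_cons,
    Matrix.tail_cons]
  push_cast; ring

/-- An integer form in `z_E^π = (π, πℓ₂, πρ_E)` is `π · (g₀ + g₁ ℓ₂ + g₂ ρ_E)`. -/
theorem zEpi_form (g : Fin 3 → ℤ) :
    ∑ i, (g i : ℂ) * zEpi i =
      (Real.pi : ℂ) * (((g 0 : ℝ) + g 1 * liouvilleNumber 2 + g 2 * rhoE : ℝ) : ℂ) := by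
  rw [Fin.sum_univ_three]
  simp only [zEpi, Matrix.cons_val_zero, Matrix.cons_val_one, Matrix.cons_val_two, Matrix.head_cons,
    Matrix.tail_cons]
  push_cast; ring

/-- The norm of an integer form in `z_E` is `|g₀ + g₁ ℓ₂ + g₂ ρ_E|`. -/
theorem norm_zE_form (g : Fin 3 → ℤ) :
    ‖∑ i, (g i : ℂ) * zE i‖ = |(g 0 : ℝ) + g 1 * liouvilleNumber 2 + g 2 * rhoE| := by
  rw [zE_form, Complex.norm_real, Real.norm_eq_abs]

/-- The norm of an integer form in `z_E^π` is `π · |g₀ + g₁ ℓ₂ + g₂ ρ_E|`. -/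
theorem norm_zEpi_form (g : Fin 3 → ℤ) :
    ‖∑ i, (g i : ℂ) * zEpi i‖ = Real.pi * |(g 0 : ℝ) + g 1 * liouvilleNumber 2 + g 2 * rhoE| := by
  rw [zEpi_form, norm_mul, Complex.norm_real, Complex.norm_real, Real.norm_eq_abs, Real.norm_eq_abs,
    abs_of_pos Real.pi_pos]

/-- No non-zero integer relation among `1, ℓ₂, ρ_E`. -/
theorem zE_form_ne_zero (g : Fin 3 → ℤ) (hg : g ≠ 0) :
    (g 0 : ℝ) + g 1 * liouvilleNumber 2 + g 2 * rhoE ≠ 0 := by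
  intro h0
  have := formE_lower_bound g hg
  rw [h0, abs_zero] at this
  exact absurd this (not_le.mpr (Real.exp_pos _))

/-- From integer to rational relations (clearing denominators). -/
private theorem linearIndependent_of_int_forms {z : Fin 3 → ℂ}
    (hz : ∀ g : Fin 3 → ℤ, g ≠ 0 → ∑ i, (g i : ℂ) * z i ≠ 0) : LinearIndependent ℚ z := by
  rw [Fintype.linearIndependent_iff]
  intro g hg
  by_contra hne
  obtain ⟨i₀, hi₀⟩ := not_forall.mp hne
  have hg' : ((g 0 : ℚ) : ℂ) * z 0 + ((g 1 : ℚ) : ℂ) * z 1 + ((g 2 : ℚ) : ℂ) * z 2 = 0 := by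
    simpa [Rat.smul_def, Fin.sum_univ_three] using hg
  have e0 : ((g 0 : ℚ) : ℂ) * ((g 0).den : ℂ) = ((g 0).num : ℂ) := by
    exact_mod_cast Rat.mul_den_eq_num (g 0)
  have e1 : ((g 1 : ℚ) : ℂ) * ((g 1).den : ℂ) = ((g 1).num : ℂ) := by
    exact_mod_cast Rat.mul_den_eq_num (g 1)
  have e2 : ((g 2 : ℚ) : ℂ) * ((g 2).den : ℂ) = ((g 2).num : ℂ) := by
    exact_mod_cast Rat.mul_den_eq_num (g 2)
  set H : Fin 3 → ℤ := ![(g 0).num * ((g 1).den * (g 2).den : ℕ),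
    (g 1).num * ((g 0).den * (g 2).den : ℕ), (g 2).num * ((g 0).den * (g 1).den : ℕ)] with hH
  have hd0 := (g 0).den_pos
  have hd1 := (g 1).den_pos
  have hd2 := (g 2).den_pos
  have hH0 : H ≠ 0 := by
    intro hzero
    have hnum : (g i₀).num ≠ 0 := Rat.num_ne_zero.mpr hi₀
    have hc := congr_fun hzero i₀
    fin_cases i₀
    all_goals
      simp only [hH, Pi.zero_apply] at hc
      exact mul_ne_zero hnum (by positivity) hc
  have hrel : ∑ i, (H i : ℂ) * z i = 0 := by
    rw [Fin.sum_univ_three]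
    simp only [hH, Matrix.cons_val_zero, Matrix.cons_val_one, Matrix.cons_val_two, Matrix.head_cons,
      Matrix.tail_cons]
    push_cast
    linear_combination (-(((g 1).den : ℂ) * ((g 2).den : ℂ) * z 0)) * e0
      - (((g 0).den : ℂ) * ((g 2).den : ℂ) * z 1) * e1
      - (((g 0).den : ℂ) * ((g 1).den : ℂ) * z 2) * e2
      + (((g 0).den : ℂ) * ((g 1).den : ℂ) * ((g 2).den : ℂ)) * hg'
  exact hz H hH0 hrel

/-- **(i) `z_E` is ℚ-linearly independent** (hypothesis-free). -/
theorem linearIndependent_zE : LinearIndependent ℚ zE := by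
  refine linearIndependent_of_int_forms fun g hg hrel => ?_
  have h := zE_form g
  rw [hrel] at h
  exact zE_form_ne_zero g hg (by exact_mod_cast h.symm)

/-- **(i^π) `z_E^π` is ℚ-linearly independent** (hypothesis-free). -/
theorem linearIndependent_zEpi : LinearIndependent ℚ zEpi := by
  refine linearIndependent_of_int_forms fun g hg hrel => ?_
  have h := zEpi_form g
  rw [hrel] at h
  have hπ0 : (Real.pi : ℂ) ≠ 0 := by exact_mod_cast Real.pi_ne_zero
  have h' := (mul_eq_zero.mp h.symm).resolve_left hπ0
  exact zE_form_ne_zero g hg (by exact_mod_cast h')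

/-- **(ii) `z_E` is Liouville to every polynomial order** (through its prefix `(1, ℓ₂)`; hypothesis-free). -/
theorem linLiouville_zE : LinLiouville zE := by
  have hℓ : Liouville (liouvilleNumber 2) := by
    simpa using liouville_liouvilleNumber (le_refl 2)
  refine linLiouville_of_prefix (k := 2) (n := 3) (by norm_num) ?_
  have h2 : (fun i : Fin 2 => zE (Fin.castLE (show 2 ≤ 3 by norm_num) i)) =
      ![(1 : ℂ), ((liouvilleNumber 2 : ℝ) : ℂ) * 1] := by
    funext i; fin_cases i <;> simp [zE]
  rw [h2]
  exact linLiouville_of_liouville_ratio hℓ 1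

/-- **(ii^π) `z_E^π` is Liouville to every polynomial order** (prefix `(π, πℓ₂)`; hypothesis-free). -/
theorem linLiouville_zEpi : LinLiouville zEpi := by
  have hℓ : Liouville (liouvilleNumber 2) := by
    simpa using liouville_liouvilleNumber (le_refl 2)
  refine linLiouville_of_prefix (k := 2) (n := 3) (by norm_num) ?_
  have h2 : (fun i : Fin 2 => zEpi (Fin.castLE (show 2 ≤ 3 by norm_num) i)) =
      ![(Real.pi : ℂ), ((liouvilleNumber 2 : ℝ) : ℂ) * (Real.pi : ℂ)] := by
    funext i; fin_cases i <;> simp [zEpi, mul_comm]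
  rw [h2]
  exact linLiouville_of_liouville_ratio hℓ (Real.pi : ℂ)

/-- **(iii) `z_E` has NO hyper-small integer forms** (the shared-digit certificate §7; hypothesis-free). -/
theorem not_hyperLinLiouville_zE : ¬ HyperLinLiouville zE := by
  intro hH
  obtain ⟨g, hg, hlt⟩ := hH 12
  rw [norm_zE_form] at hlt
  have hlow := formE_lower_bound g hg
  have hX : (1 : ℝ) ≤ 1 + ∑ i, (|g i| : ℝ) := by
    have : (0 : ℝ) ≤ ∑ i, (|g i| : ℝ) :=
      Finset.sum_nonneg fun i _ => by exact_mod_cast abs_nonneg (g i)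
    linarith
  have hmono : (1 + ∑ i, (|g i| : ℝ)) ^ 11 ≤ (1 + ∑ i, (|g i| : ℝ)) ^ 12 :=
    pow_le_pow_right₀ hX (by norm_num)
  have := Real.exp_le_exp.mpr (neg_le_neg hmono)
  linarith

/-- **(iii^π) `z_E^π` has NO hyper-small integer forms** (`|π·form| ≥ |form|`; hypothesis-free). -/
theorem not_hyperLinLiouville_zEpi : ¬ HyperLinLiouville zEpi := by
  intro hH
  obtain ⟨g, hg, hlt⟩ := hH 12
  rw [norm_zEpi_form] at hlt
  have hlow := formE_lower_bound g hg
  have hX : (1 : ℝ) ≤ 1 + ∑ i, (|g i| : ℝ) := by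
    have : (0 : ℝ) ≤ ∑ i, (|g i| : ℝ) :=
      Finset.sum_nonneg fun i _ => by exact_mod_cast abs_nonneg (g i)
    linarith
  have hmono : (1 + ∑ i, (|g i| : ℝ)) ^ 11 ≤ (1 + ∑ i, (|g i| : ℝ)) ^ 12 :=
    pow_le_pow_right₀ hX (by norm_num)
  have := Real.exp_le_exp.mpr (neg_le_neg hmono)
  have hπ : (1 : ℝ) ≤ Real.pi := by have := Real.pi_gt_three; linarith
  have habs := abs_nonneg ((g 0 : ℝ) + g 1 * liouvilleNumber 2 + g 2 * rhoE)
  nlinarith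

/-- **(iv) Schanuel's bound AT `z_E`** (mod `hNW` only). -/
theorem sb_zE (hNW : NWMeasure) : SB 3 zE := sb_logLogCell hNW logLogLiouville_rhoE

/-- **(iv^π) Schanuel's bound AT `z_E^π` — HYPOTHESIS-FREE.** -/
theorem sb_zEpi : SB 3 zEpi := sb_logLogCell_pi logLogLiouville_rhoE

/-- **`z_E` lies in the scope of item 33364** — all three hypotheses, hypothesis-free. -/
theorem zE_in_scope_33364 :
    LinearIndependent ℚ zE ∧
    (∀ ω : ℕ, ∃ h : Fin 3 → ℤ, h ≠ 0 ∧ ‖∑ i, (h i : ℂ) * zE i‖ < 1 / (1 + ∑ i, (|h i| : ℝ)) ^ ω) ∧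
    (¬ ∀ m : ℕ, ∃ h : Fin 3 → ℤ, h ≠ 0 ∧
      ‖∑ i, (h i : ℂ) * zE i‖ < Real.exp (-((1 + ∑ i, (|h i| : ℝ)) ^ m))) :=
  ⟨linearIndependent_zE, linLiouville_zE, not_hyperLinLiouville_zE⟩

/-- **`z_E^π` lies in the scope of item 33364** — all three hypotheses, hypothesis-free. -/
theorem zEpi_in_scope_33364 :
    LinearIndependent ℚ zEpi ∧
    (∀ ω : ℕ, ∃ h : Fin 3 → ℤ, h ≠ 0 ∧ ‖∑ i, (h i : ℂ) * zEpi i‖ < 1 / (1 + ∑ i, (|h i| : ℝ)) ^ ω) ∧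
    (¬ ∀ m : ℕ, ∃ h : Fin 3 → ℤ, h ≠ 0 ∧
      ‖∑ i, (h i : ℂ) * zEpi i‖ < Real.exp (-((1 + ∑ i, (|h i| : ℝ)) ^ m))) :=
  ⟨linearIndependent_zEpi, linLiouville_zEpi, not_hyperLinLiouville_zEpi⟩

/-- **ITEM 33364 DECIDED AT `z_E`** (mod `hNW`): scope (i)–(iii) hypothesis-free AND the conclusion. -/
theorem finiteOrderLiouvilleSchanuel_at_zE (hNW : NWMeasure) :
    LinearIndependent ℚ zE ∧ LinLiouville zE ∧ ¬ HyperLinLiouville zE ∧ SB 3 zE :=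
  ⟨linearIndependent_zE, linLiouville_zE, not_hyperLinLiouville_zE, sb_zE hNW⟩

/-- **ITEM 33364 DECIDED AT `z_E^π` — HYPOTHESIS-FREE**: scope (i)–(iii) AND the conclusion. -/
theorem finiteOrderLiouvilleSchanuel_at_zEpi :
    LinearIndependent ℚ zEpi ∧ LinLiouville zEpi ∧ ¬ HyperLinLiouville zEpi ∧ SB 3 zEpi :=
  ⟨linearIndependent_zEpi, linLiouville_zEpi, not_hyperLinLiouville_zEpi, sb_zEpi⟩

/-- **`z_E` is NOT on g34's cell nor on the route's hyper-Liouville class**: its third coordinate is NOT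
log-square-Liouville (tree class BY NAME), hence not log-hyper-Liouville, not hyper-Liouville; and its Liouville
prefix `ℓ₂` is not log-square-Liouville either (tree `not_logSqLiouville_liouvilleNumber`). -/
theorem zE_outside_previous_cells :
    ¬ Summit.Schanuel.Schanuel.Theorems.RootDecomp1KGeneric.LogSqLiouville rhoE ∧
    ¬ Summit.Schanuel.Schanuel.Theorems.RootDecomp1KRelLiouvilleCell.LogHyperLiouville rhoE ∧
    ¬ Summit.Schanuel.Schanuel.Theorems.RootDecomp1KHyper.HyperCell.HyperLiouville rhoE ∧
    ¬ Summit.Schanuel.Schanuel.Theorems.RootDecomp1KGeneric.LogSqLiouville (liouvilleNumber 2) :=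
  ⟨not_logSqLiouville_rhoE, not_logHyperLiouville_rhoE, not_hyperLiouville_rhoE,
    by simpa using not_logSqLiouville_liouvilleNumber (le_refl 2)⟩

end Cells

end Summit.Schanuel.Schanuel.Theorems.RootDecomp1KLogLogCell
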